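import Summits.Ventures.Crystal3D.Bulk.GapHullConnected
import Summits.Ventures.Crystal3D.Bulk.GapCensusRowsStar
import HarnessLib

/-!
# Euler consequences for the oriented tight map under the census rows: total angular excess `4π`
# and the planar-map bounds `E ≤ 3V′ − 6`, `F° ≤ 2V′ − 4` (LEAN-FACES-DESIGN §5.3)

HONEST FRAMING. Part of the venture `Summits/Ventures/Crystal3D` (cell `pub-crystal3d`, phase 2;
seat p3). Kernel consequences of `Bulk/GapHullEuler.lean` / `Bulk/GapHullConnected.lean` for a
configuration satisfying typer-bulk-2's `CensusRows c` (the kernel rows of the GAP census) AND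
the connectedness assumption `TightConnected c` (P-L3(b) L1 — NOT proved here, a hypothesis);
nothing is asserted about GAP(1.26):

* `CensusRows.darts_nonempty` (the intruder touches `≥ 3` shell balls);
* **`CensusRows.oriented_euler_of_tightConnected`** —
  `#activeVertices − tightCount + onumFaces = 2`;
* **`CensusRows.total_excess_of_tightConnected`** — the total angular excess of the oriented faces
  is `4π` (typer-bulk-2's `oriented_euler_iff_excess`: the Gauss–Bonnet side of Euler);
* **`CensusRows.tightCount_le_of_tightConnected`** (`E ≤ 3V′ − 6`) and
  **`CensusRows.onumFaces_le_of_tightConnected`** (`F° ≤ 2V′ − 4`) — from Euler and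
  `3F° ≤ 2E` (every oriented face has `≥ 3` darts, `CensusRows.three_mul_onumFaces_le`).
-/

noncomputable section

namespace Summit.Ventures.Crystal3D

open Literature.Geometry.DiscreteGeometry Finset Equiv HullRotSys

variable {c : Fin 14 → EuclideanSpace ℝ (Fin 3)}

/-- Under the census rows `intruderDist c < 3/2`. -/
theorem CensusRows.intruderDist_lt_three_halves (h : CensusRows c) : intruderDist c < 3 / 2 := by
  have := h.intruderDist_le
  linarith

/-- Under the census rows the tight graph has a dart (the intruder touches `≥ 3` shell balls). -/
theorem CensusRows.darts_nonempty (h : CensusRows c) : (darts c).Nonempty := by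
  have h3 := h.three_le_card_intruderContacts
  obtain ⟨j, hj⟩ : (univ.filter fun j : Fin 14 => j ≠ 0 ∧ j ≠ 13 ∧ dist (c 13) (c j)
      = 1).Nonempty := by
    rw [← Finset.card_pos]; omega
  rw [mem_filter] at hj
  obtain ⟨-, hj0, hj13, hdist⟩ := hj
  have h13 : (13 : Fin 14) ≠ 0 := by decide
  exact ⟨(13, j), mem_darts.2 ⟨h13, hj0, fun h13' => hj13 h13'.symm, hdist⟩⟩

/-- **Euler's relation `V′ − E + F° = 2` for the oriented tight map of a census configuration
whose tight graph is connected.** -/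
theorem CensusRows.oriented_euler_of_tightConnected (h : CensusRows c)
    (hconn : TightConnected c) :
    ((activeVertices c).card : ℤ) - tightCount c + onumFaces c = 2 :=
  h.isGapConfig.oriented_euler_of_tightConnected' h.intruderDist_lt_three_halves hconn
    h.darts_nonempty

/-- **Total angular excess `4π`**: for a census configuration with connected tight graph, the
corner sums of the oriented faces satisfy `Σ_F (Σ corners − (#F − 2)π) = 4π`. -/
theorem CensusRows.total_excess_of_tightConnected (h : CensusRows c) (hconn : TightConnected c) :
    ∑ F ∈ ofaces c, (ofaceAngleSum c F - ((F.card : ℝ) - 2) * Real.pi) = 4 * Real.pi := by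
  obtain ⟨hD3, -, -⟩ := h.intruderDist_bounds
  rw [← h.isGapConfig.oriented_euler_iff_excess hD3]
  have hz := h.oriented_euler_of_tightConnected hconn
  exact_mod_cast hz

/-- **`E ≤ 3V′ − 6`**: a census configuration with connected tight graph has at most
`3·#activeVertices − 6` tight pairs. -/
theorem CensusRows.tightCount_le_of_tightConnected (h : CensusRows c) (hconn : TightConnected c) :
    tightCount c + 6 ≤ 3 * (activeVertices c).card := by
  have he := h.oriented_euler_of_tightConnected hconn
  have hf := h.three_mul_onumFaces_le
  omega

/-- **`F° ≤ 2V′ − 4`**: a census configuration with connected tight graph has at most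
`2·#activeVertices − 4` oriented faces. -/
theorem CensusRows.onumFaces_le_of_tightConnected (h : CensusRows c) (hconn : TightConnected c) :
    onumFaces c + 4 ≤ 2 * (activeVertices c).card := by
  have he := h.oriented_euler_of_tightConnected hconn
  have hf := h.three_mul_onumFaces_le
  omega

end Summit.Ventures.Crystal3D
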